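import Mathlib.FieldTheory.Finite.Extension
import Mathlib.Algebra.Polynomial.Lifts
import Mathlib.RingTheory.IntegralDomain
import Literature.Computability.Complexity.UmansFPField
import HarnessLib

/-!
# Umans' field setup: an irreducible polynomial over `F_q` with coefficients in the subfield `F_h`

Literature / circuit complexity — derandomization (C. Umans, *Pseudo-random generators for all
hardnesses*, JCSS 67 (2003), §3, Lemma 7: "Let `p(z)` be an irreducible polynomial of degree `d`
over `F_h`; if `gcd(d, log_h q) = 1` then `p` is irreducible over `F_q`"). The generator needs the
extension `L = F_{q^d}` presented as `F_q[z]/(p)` with `p ∈ F_h[z]`, so that the `F_h`-span of the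
power basis is the subfield `F_{h^d}` carrying the truth table. This file proves the EXISTENCE of
such a `p` (so that the generator's exhaustive search succeeds), by an elementary argument inside a
degree-`d` extension `E` of `K = F_q` (`FiniteField.Extension`): for a generator `γ` of the cyclic
group of order `h^d - 1` in `E^×`, the conjugates `γ, γ^h, …, γ^{h^{d-1}}` are distinct and permuted
cyclically by `x ↦ x^h`, so `f = Π_i (X - γ^{hⁱ})` has coefficients fixed by `x ↦ x^h` (hence in
`K`, indeed in `F_h`), and any monic factor of `f` over `K` of positive degree has its roots closed
under `x ↦ x^q = x^{h^c}`; as `gcd(c, d) = 1` the `q`-orbit of `γ` is all `d` conjugates, so the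
factor is `f`: `f` is irreducible over `K`.

* `UmansField.exists_irreducible_fixed` — for `|K| = h^c`, `h = p^a`, `gcd(c, d) = 1`: a monic
  irreducible `g ∈ K[X]` of degree `d` with `(g.coeff i)^h = g.coeff i` for all `i`;
* `UmansField.exists_irreducible_fixed_GF2` — the case `K = GF2 M` (`|K| = 2^{M+1}`, `M + 1 = a c`).

Everything is proved; no named fact.

## References

* C. Umans, *Pseudo-random generators for all hardnesses*, JCSS 67 (2003), §3, Lemma 7 [Umans2003].
* R. Lidl, H. Niederreiter, *Finite Fields*, 2nd ed., CUP 1996/1997, Thm. 3.46 (irreducibility over extension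
  fields and `gcd` of degrees) [LidlNiederreiter1996].
-/

noncomputable section

namespace Literature.Computability.Complexity

open Polynomial Finset

namespace UmansField

variable {E : Type*} [Field E]

/-! ### Conjugates of an element of order `h^d - 1` under `x ↦ x^h` -/

section Conj

variable {h d : ℕ} (hh : 2 ≤ h) (hd : 1 ≤ d) {γ : E} (hγT : γ ^ (h ^ d - 1) = 1)
  (hord : ∀ e : ℕ, 1 ≤ e → γ ^ (h ^ e - 1) = 1 → d ≤ e)
include hh hd hγT hord

omit hord in
/-- `γ ≠ 0`. [folklore] -/
theorem gamma_ne_zero : γ ≠ 0 := fun h0 => by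
  have : (0 : E) ^ (h ^ d - 1) = 1 := by rwa [h0] at hγT
  rw [zero_pow (Nat.sub_ne_zero_of_lt (Nat.one_lt_pow (by omega) (by omega)))] at this
  exact zero_ne_one this


omit hd hord in
/-- `γ^{h^d} = γ`. [folklore] -/
theorem pow_h_pow_d : γ ^ h ^ d = γ := by
  have : h ^ d = (h ^ d - 1) + 1 := (Nat.sub_add_cancel (Nat.one_le_pow _ _ (by omega))).symm
  rw [this, pow_succ, hγT, one_mul]

omit hd hord in
/-- The conjugates are periodic with period `d`. [folklore] -/
theorem conj_add_d (i : ℕ) : γ ^ h ^ (i + d) = γ ^ h ^ i := by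
  rw [pow_add, mul_comm, pow_mul, pow_h_pow_d hh hγT]

omit hd hord in
/-- The conjugates depend only on the exponent modulo `d`. [folklore] -/
theorem conj_mod (i : ℕ) : γ ^ h ^ i = γ ^ h ^ (i % d) := by
  conv_lhs => rw [← Nat.mod_add_div i d]
  generalize i / d = k
  induction k with
  | zero => rw [Nat.mul_zero, Nat.add_zero]
  | succ k ih => rw [Nat.mul_succ, ← Nat.add_assoc, conj_add_d hh hγT, ih]

/-- `γ^{h^e} = γ` forces `d ≤ e` (for `e ≥ 1`). [folklore] -/
theorem le_of_conj_eq {e : ℕ} (he : 1 ≤ e) (h1 : γ ^ h ^ e = γ) : d ≤ e := by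
  refine hord e he ?_
  have hγ0 := gamma_ne_zero hh hd hγT
  have : h ^ e = (h ^ e - 1) + 1 := (Nat.sub_add_cancel (Nat.one_le_pow _ _ (by omega))).symm
  rw [this, pow_succ] at h1
  exact mul_right_cancel₀ hγ0 (h1.trans (one_mul γ).symm)

/-- **The `d` conjugates `γ^{hⁱ}`, `i < d`, are pairwise distinct.** [cite: LidlNiederreiter1996, Thm. 2.14] -/
theorem conj_injective : Function.Injective fun i : Fin d => γ ^ h ^ (i : ℕ) := by
  intro i j hij
  simp only [] at hij
  by_contra hne
  wlog hlt : (i : ℕ) < (j : ℕ) generalizing i j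
  · exact this hij.symm (Ne.symm hne) (lt_of_le_of_ne (not_lt.1 hlt) fun e => hne (Fin.ext e).symm)
  -- raise to `h^{d - j}`: `γ^{h^{i + d - j}} = γ^{h^d} = γ`
  have e1 : (γ ^ h ^ (i : ℕ)) ^ h ^ (d - (j : ℕ)) = (γ ^ h ^ (j : ℕ)) ^ h ^ (d - (j : ℕ)) := by rw [hij]
  rw [← pow_mul, ← pow_add, ← pow_mul, ← pow_add, Nat.add_sub_cancel' j.2.le, pow_h_pow_d hh hγT] at e1
  have := le_of_conj_eq hh hd hγT hord (e := (i : ℕ) + (d - (j : ℕ))) (by omega) e1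
  omega

end Conj

/-! ### The polynomial of the conjugates -/

/-- `Π_{i<d} (X - γ^{hⁱ})`. [cite: Umans2003, Lemma 7] -/
def conjPoly (h d : ℕ) (γ : E) : E[X] := ∏ i : Fin d, (X - C (γ ^ h ^ (i : ℕ)))

/-- The conjugate polynomial is monic. [folklore] -/
theorem monic_conjPoly (h d : ℕ) (γ : E) : (conjPoly h d γ).Monic := monic_prod_of_monic _ _ fun _ _ => monic_X_sub_C _

/-- The conjugate polynomial has degree `d`. [folklore] -/
theorem natDegree_conjPoly (h d : ℕ) (γ : E) : (conjPoly h d γ).natDegree = d := by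
  rw [conjPoly, natDegree_prod_of_monic _ _ fun _ _ => monic_X_sub_C _]
  simp only [natDegree_X_sub_C, Finset.sum_const, Finset.card_univ, Fintype.card_fin, smul_eq_mul, mul_one]

/-- The conjugates are roots of the conjugate polynomial. [folklore] -/
theorem eval_conjPoly_conj (h d : ℕ) (γ : E) (i : Fin d) : (conjPoly h d γ).eval (γ ^ h ^ (i : ℕ)) = 0 := by
  rw [conjPoly, eval_prod, Finset.prod_eq_zero (Finset.mem_univ i)]
  simp

/-- **The conjugate polynomial is fixed by `x ↦ x^h`** (the map permutes its linear factors
cyclically). [cite: Umans2003, Lemma 7] -/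
theorem map_conjPoly (p : ℕ) [Fact p.Prime] [CharP E p] {h a d : ℕ} (hh : h = p ^ a) (hd : 1 ≤ d) {γ : E} (hγ : γ ^ h ^ d = γ) :
    (conjPoly h d γ).map (iterateFrobenius E p a) = conjPoly h d γ := by
  rw [conjPoly, Polynomial.map_prod]
  simp only [Polynomial.map_sub, map_X, map_C, iterateFrobenius_def, ← hh]
  -- `(γ^{h^i})^h = γ^{h^{i+1}}`, and `i ↦ i + 1` is a bijection of `Fin d` with `γ^{h^d} = γ`
  have hstep : ∀ i : Fin d, (γ ^ h ^ (i : ℕ)) ^ h = γ ^ h ^ ((finRotate d i : Fin d) : ℕ) := by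
    intro i
    rw [← pow_mul, ← pow_succ]
    obtain ⟨d', rfl⟩ : ∃ d', d = d' + 1 := ⟨d - 1, by omega⟩
    by_cases hi : i = Fin.last d'
    · subst hi
      rw [finRotate_last, Fin.val_zero, pow_zero, pow_one, Fin.val_last, hγ]
    · have hlt : (i : ℕ) < d' := lt_of_le_of_ne (Nat.le_of_lt_succ i.2) fun e => hi (Fin.ext e)
      rw [finRotate_of_lt hlt]
  simp_rw [hstep]
  exact Fintype.prod_equiv (finRotate d) _ _ fun i => rfl

/-- Coefficients of the conjugate polynomial are fixed by `x ↦ x^h`. [cite: Umans2003, Lemma 7] -/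
theorem coeff_conjPoly_pow (p : ℕ) [Fact p.Prime] [CharP E p] {h a d : ℕ} (hh : h = p ^ a) (hd : 1 ≤ d) {γ : E} (hγ : γ ^ h ^ d = γ) (j : ℕ) :
    ((conjPoly h d γ).coeff j) ^ h = (conjPoly h d γ).coeff j := by
  have := congrArg (fun f : E[X] => f.coeff j) (map_conjPoly p hh hd hγ)
  simp only [coeff_map, iterateFrobenius_def, ← hh] at this
  exact this

/-! ### Roots of polynomials with fixed coefficients -/

/-- If the coefficients of `F` are fixed by `x ↦ x^N` then so is its root set. [folklore] -/
theorem eval_pow_of_coeff_pow (p : ℕ) [Fact p.Prime] [CharP E p] {n : ℕ} {F : E[X]} (hF : ∀ j, (F.coeff j) ^ p ^ n = F.coeff j)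
    {y : E} (hy : F.eval y = 0) : F.eval (y ^ p ^ n) = 0 := by
  have hmap : F.map (iterateFrobenius E p n) = F := by
    ext j; rw [coeff_map, iterateFrobenius_def, hF]
  have : F.eval (iterateFrobenius E p n y) = 0 := by
    conv_lhs => rw [← hmap]
    rw [eval_map, eval₂_at_apply, hy, map_zero]
  rwa [iterateFrobenius_def] at this

/-! ### The existence theorem -/

variable {K : Type*} [Field K] [Fintype K]

/-- **An irreducible polynomial of degree `d` over `F_q` with coefficients in `F_h`**
(`q = h^c`, `h = p^a`, `gcd(c, d) = 1`). [cite: Umans2003, §3, Lemma 7; LidlNiederreiter1996, Thm. 3.46] -/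
theorem exists_irreducible_fixed (p : ℕ) [Fact p.Prime] [CharP K p] {h a c d : ℕ} (hh : h = p ^ a) (ha : 1 ≤ a)
    (hK : Fintype.card K = h ^ c) (hc : 1 ≤ c) (hd : 1 ≤ d) (hcd : Nat.Coprime c d) :
    ∃ g : K[X], g.Monic ∧ g.natDegree = d ∧ Irreducible g ∧ ∀ i, (g.coeff i) ^ h = g.coeff i := by
  classical
  have hp : p.Prime := Fact.out
  have h2 : 2 ≤ h := by rw [hh]; exact le_trans hp.two_le (Nat.le_self_pow (by omega) p)
  -- the extension `E` of degree `d`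
  haveI : NeZero d := ⟨by omega⟩
  let E := FiniteField.Extension K p d
  letI : Fintype E := Fintype.ofFinite E
  haveI : CharP E p := charP_of_injective_algebraMap (algebraMap K E).injective p
  have hcardE : Fintype.card E = h ^ (c * d) := by
    rw [← Nat.card_eq_fintype_card, FiniteField.natCard_extension, Nat.card_eq_fintype_card, hK, ← pow_mul]
  -- an element of order `h^d - 1`
  set N := h ^ (c * d) - 1 with hN
  set T := h ^ d - 1 with hT
  have hT1 : 1 ≤ T := Nat.le_sub_one_of_lt (Nat.one_lt_pow (by omega) (by omega))
  have hTN : T ∣ N := by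
    rw [hT, hN]
    exact Nat.pow_sub_one_dvd_pow_sub_one (x := h) (dvd_mul_left d c)
  obtain ⟨ζ, hζ⟩ := IsCyclic.exists_ofOrder_eq_natCard (α := Eˣ)
  have hζN : orderOf ζ = N := by rw [hζ, Nat.card_eq_fintype_card, Fintype.card_units, hcardE]
  set γu : Eˣ := ζ ^ (N / T) with hγu
  have hNT : N / T ≠ 0 := by
    intro h0
    have := Nat.div_eq_zero_iff.1 h0
    rcases this with hT0 | hlt
    · omega
    · have : T ≤ N := Nat.le_of_dvd (by
        rw [hN]; exact Nat.sub_pos_of_lt (Nat.one_lt_pow (by positivity) (by omega))) hTN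
      omega
  have hγord : orderOf γu = T := by
    rw [hγu, orderOf_pow' _ hNT, hζN, Nat.gcd_eq_right (Nat.div_dvd_of_dvd hTN), Nat.div_div_self hTN (by
      rw [hN]; exact Nat.sub_ne_zero_of_lt (Nat.one_lt_pow (by positivity) (by omega)))]
  set γ : E := (γu : E) with hγdef
  have hγT : γ ^ T = 1 := by
    rw [hγdef, ← Units.val_pow_eq_pow_val, ← hγord, pow_orderOf_eq_one, Units.val_one]
  have hord : ∀ e : ℕ, 1 ≤ e → γ ^ (h ^ e - 1) = 1 → d ≤ e := by
    intro e he h1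
    have hdvd : T ∣ h ^ e - 1 := by
      rw [← hγord]
      refine orderOf_dvd_of_pow_eq_one ?_
      ext; rw [Units.val_pow_eq_pow_val, ← hγdef, h1, Units.val_one]
    have hle : h ^ d - 1 ≤ h ^ e - 1 := Nat.le_of_dvd (Nat.sub_pos_of_lt (Nat.one_lt_pow (by omega) (by omega))) hdvd
    have : h ^ d ≤ h ^ e := by
      have := Nat.one_le_pow e h (by omega); have := Nat.one_le_pow d h (by omega); omega
    exact (Nat.pow_le_pow_iff_right (by omega)).1 this
  have hγhd : γ ^ h ^ d = γ := pow_h_pow_d h2 hγT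
  -- the conjugate polynomial and its descent to `K`
  set f : E[X] := conjPoly h d γ with hf
  have hcoef : ∀ j, (f.coeff j) ^ h = f.coeff j := coeff_conjPoly_pow p hh hd hγhd
  have hfix : ∀ {y : E}, y ^ h = y → ∀ k : ℕ, y ^ h ^ k = y := by
    intro y hy k
    induction k with
    | zero => rw [pow_zero, pow_one]
    | succ k ih => rw [pow_succ, pow_mul, ih, hy]
  have hcoefq : ∀ j, (f.coeff j) ^ Fintype.card K = f.coeff j := fun j => by rw [hK]; exact hfix (hcoef j) c
  -- elements fixed by `x ↦ x^q` come from `K`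
  have hrange : ∀ y : E, y ^ Fintype.card K = y → y ∈ Set.range (algebraMap K E) := by
    intro y hy
    -- the roots of `X^q - X` in `E` are the `q` elements of `K`
    set R : E[X] := X ^ Fintype.card K - X with hR
    have hq1 : 1 < Fintype.card K := Fintype.one_lt_card
    have hR0 : R ≠ 0 := FiniteField.X_pow_card_sub_X_ne_zero E hq1
    have hdeg : R.natDegree = Fintype.card K := FiniteField.X_pow_card_sub_X_natDegree_eq E hq1
    have hKroots : (univ.image (algebraMap K E)) ⊆ R.roots.toFinset := by
      intro z hz
      obtain ⟨x, -, rfl⟩ := mem_image.1 hz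
      rw [Multiset.mem_toFinset, mem_roots hR0, IsRoot.def, hR, eval_sub, eval_pow, eval_X, ← map_pow, FiniteField.pow_card, sub_self]
    have hcardK : (univ.image (algebraMap K E)).card = Fintype.card K := by
      rw [card_image_of_injective _ (algebraMap K E).injective, card_univ]
    have hfull : univ.image (algebraMap K E) = R.roots.toFinset := by
      apply eq_of_subset_of_card_le hKroots
      rw [hcardK]
      exact (Multiset.toFinset_card_le _).trans ((card_roots' R).trans hdeg.le)
    have hyR : y ∈ R.roots.toFinset := by
      rw [Multiset.mem_toFinset, mem_roots hR0, IsRoot.def, hR, eval_sub, eval_pow, eval_X, hy, sub_self]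
    rw [← hfull] at hyR
    obtain ⟨x, -, hx⟩ := mem_image.1 hyR
    exact ⟨x, hx⟩
  have hlifts : f ∈ lifts (algebraMap K E) := (lifts_iff_coeff_lifts f).2 fun j => hrange _ (hcoefq j)
  obtain ⟨g, hgf, hgdeg, hgmon⟩ := lifts_and_natDegree_eq_and_monic hlifts (monic_conjPoly h d γ)
  rw [natDegree_conjPoly] at hgdeg
  refine ⟨g, hgmon, hgdeg, ?_, fun i => ?_⟩
  · -- irreducibility
    have hq : Fintype.card K = p ^ (a * c) := by rw [hK, hh, ← pow_mul]
    -- every monic factor of `g` over `K` vanishing at `γ` has all `d` conjugates as roots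
    have key : ∀ F : K[X], F.Monic → (F.map (algebraMap K E)).eval γ = 0 → d ≤ F.natDegree := by
      intro F hF hFγ
      set F' := F.map (algebraMap K E) with hF'
      have hF'0 : F' ≠ 0 := (hF.map _).ne_zero
      have hF'deg : F'.natDegree = F.natDegree := natDegree_map_eq_of_injective (algebraMap K E).injective _
      have hcoefF : ∀ j, (F'.coeff j) ^ p ^ (a * c) = F'.coeff j := by
        intro j
        rw [hF', coeff_map, ← map_pow, ← hq, FiniteField.pow_card]
      -- all `γ^{q^j}` are roots
      have hrootq : ∀ j : ℕ, F'.eval (γ ^ (Fintype.card K) ^ j) = 0 := by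
        intro j
        induction j with
        | zero => rwa [pow_zero, pow_one]
        | succ j ih =>
          rw [pow_succ, pow_mul]
          rw [hq] at ih ⊢
          exact eval_pow_of_coeff_pow p hcoefF ih
      -- hence all conjugates `γ^{h^i}`, `i < d`
      have hrooth : ∀ i : Fin d, F'.eval (γ ^ h ^ (i : ℕ)) = 0 := by
        -- `j ↦ c j mod d` is onto
        have hsurj : Function.Surjective fun j : Fin d => (⟨c * (j : ℕ) % d, Nat.mod_lt _ (by omega)⟩ : Fin d) := by
          refine Finite.injective_iff_surjective.1 fun j j' hjj' => ?_
          simp only [Fin.mk.injEq] at hjj'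
          apply Fin.ext
          have hmod : c * (j : ℕ) ≡ c * (j' : ℕ) [MOD d] := hjj'
          exact Nat.ModEq.eq_of_lt_of_lt (Nat.ModEq.cancel_left_of_coprime hcd.symm hmod) j.2 j'.2
        intro i
        obtain ⟨j, hj⟩ := hsurj i
        have hij : (i : ℕ) = c * (j : ℕ) % d := by rw [← hj]
        rw [hij, ← conj_mod h2 hγT, pow_mul, ← hK]
        exact hrootq j
      -- `d` distinct roots of a nonzero polynomial of degree `deg F`
      have hsub : (univ.image fun i : Fin d => γ ^ h ^ (i : ℕ)) ⊆ F'.roots.toFinset := by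
        intro y hy
        obtain ⟨i, -, rfl⟩ := mem_image.1 hy
        rw [Multiset.mem_toFinset, mem_roots hF'0, IsRoot.def]
        exact hrooth i
      have := card_le_card hsub
      rw [card_image_of_injective _ (conj_injective h2 hd hγT hord), card_univ, Fintype.card_fin] at this
      rw [← hF'deg]
      exact this.trans ((Multiset.toFinset_card_le _).trans (card_roots' F'))
    rw [hgmon.irreducible_iff_natDegree]
    refine ⟨fun h1 => by have := congrArg natDegree h1; rw [hgdeg, natDegree_one] at this; omega, fun f₁ f₂ hf₁ hf₂ hmul => ?_⟩
    by_contra hcon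
    push Not at hcon
    have hdeg12 : f₁.natDegree + f₂.natDegree = d := by rw [← hgdeg, ← hmul, hf₁.natDegree_mul hf₂]
    -- `γ` is a root of `g`, hence of `f₁` or `f₂`
    have hγg : (g.map (algebraMap K E)).eval γ = 0 := by
      rw [hgf, hf]
      have := eval_conjPoly_conj h d γ ⟨0, by omega⟩
      rwa [Fin.val_mk, pow_zero, pow_one] at this
    rw [← hmul, Polynomial.map_mul, eval_mul, mul_eq_zero] at hγg
    rcases hγg with h0 | h0
    · have := key f₁ hf₁ h0; omega
    · have := key f₂ hf₂ h0; omega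
  · have := congrArg (fun q : E[X] => q.coeff i) hgf
    simp only [coeff_map] at this
    apply (algebraMap K E).injective
    rw [map_pow, this, hcoef]

/-- **The case `K = GF2 M`** (`|K| = 2^{M+1}`, `M + 1 = a c`, `h = 2^a`): a monic irreducible
polynomial of degree `d` over `GF2 M` whose coefficients lie in the subfield of order `2^a`.
[cite: Umans2003, §3, Lemma 7] -/
theorem exists_irreducible_fixed_GF2 (M : ℕ) {a c d : ℕ} (hM : M + 1 = a * c) (ha : 1 ≤ a) (hd : 1 ≤ d) (hcd : Nat.Coprime c d) :
    ∃ g : (Literature.InformationTheory.Coding.GF2 M)[X], g.Monic ∧ g.natDegree = d ∧ Irreducible g ∧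
      ∀ i, (g.coeff i) ^ (2 ^ a) = g.coeff i := by
  haveI : Fact (Nat.Prime 2) := ⟨Nat.prime_two⟩
  haveI : CharP (Literature.InformationTheory.Coding.GF2 M) 2 := Literature.InformationTheory.Coding.GF2.charP M
  have hc : 1 ≤ c := Nat.pos_of_ne_zero fun h0 => by rw [h0, Nat.mul_zero] at hM; omega
  exact exists_irreducible_fixed 2 rfl ha (by rw [UmansFP.card_GF2, hM, pow_mul]) hc hd hcd

end UmansField

end Literature.Computability.Complexity

end
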